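import Summits.AtomisticToContinuum.FouriersLaw.Theorems.PhononMeanFreePathIncoherentChannelContactLoss
import Summits.AtomisticToContinuum.FouriersLaw.Theorems.IncoherentChannel.Negative.LineResistance
/-!
# `IncoherentChannel`, line `two-horizons-forecast-loss` — SHORT-TIME PERSISTENCE of the echo and of the forecast norm

Helper file for the lead's stub `stub_forecastLoss` (the ENGINE) of crux `PhononMeanFreePath.IncoherentChannel`
(item stmt-AtomisticToContinuum-11811, route `PhononMeanFreePath`, sub-problem `FouriersLaw`), vocabulary of
`PhononMeanFreePathDefs`: for the `(N+1)`-site pinned anharmonic chain `pinnedChain ω₂ lam β γ` with both baths at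
`T` (`μ₀ = gibbsMeasure (N+1) T`, `K_t = transitionKernel (N+1) T T t⁺`, the CONSTRUCTED objects),
`v_t = fcast … N t = K_t p_N` is the mean forecast of the bath momentum `p_N`, `S_N(t) = fnorm … N t = ‖v_t‖²_{L²(μ₀)}`
the forecast norm and `a_N(t) = ⟨p_N, v_t⟩_{μ₀} = E[p_N(0) p_N(t)]` the echo of the bath momentum.

This file proves the `N`-UNIFORM LOWER short-time law matching the `N`-uniform UPPER law `contactLoss_fnorm_le`
(`S_N(t) ≤ T − t(√(2γT) − D√t)²`): the echo cannot drop faster than linearly, uniformly in the length of the chain,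

  `|a_N(t) − T| ≤ D t`,  hence  `T − D t ≤ a_N(t)`  and  `(T − D t)² / T ≤ S_N(t)`  (`0 ≤ t`, `D t ≤ T`),

with `D = √T · √D²`, `D² = D²(ω₂, lam, β, γ, T)` the `N`-uniform Gibbs second moment of the bath-site drift
(`endAutocorr_sub_abs_le_of_driftBound`, `endAutocorr_persistence`, `fnorm_persistence`). MECHANISM: on the product
space `μ₀ ⊗ W` (initial Gibbs state, pair of bath Brownian motions) the pathwise Langevin equation of the bath
momentum reads `p_N(t) = p_N(0) + √(2γT) B_t + ∫₀ᵗ Y_N(z_s) ds` (`contactLoss_momentum_sde`), so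

  `a_N(t) = E[p_N(0) p_N(t)] = E[p_N(0)²] + √(2γT) E[p_N(0) B_t] + E[p_N(0) ∫₀ᵗ Y_N] = T + 0 + E[p_N(0) ∫₀ᵗ Y_N]`

(equipartition; `p_N(0)` depends on `z` only and `B_t` on `w` only with mean zero), and Cauchy–Schwarz on `μ₀ ⊗ W`
with the `N`-uniform bound `E(∫₀ᵗ Y_N)² ≤ t² D²` (`contactLoss_lintegral_driftIntegral_sq_le`) gives
`|E[p_N(0) ∫₀ᵗ Y_N]| ≤ √T · t √D²`. The corollary for `S_N` is Cauchy–Schwarz in `L²(μ₀)`: `a_N(t)² ≤ T S_N(t)`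
(`endAutocorr_sq_le_fnorm`). Valid at the harmonic corner `lam = β = 0` and at `γ = 0` as well (every input is).
No definitions; nothing here closes an item.
-/


noncomputable section

namespace Summit.AtomisticToContinuum.FouriersLaw.Theorems.PhononMeanFreePath

open MeasureTheory ProbabilityTheory Set Filter Topology
open scoped NNReal ENNReal
open Literature.MathematicalPhysics.KineticTheory.HeatConduction
open Literature.MathematicalPhysics.KineticTheory Literature.Probability.Process OscillatorChain
open Summit.AtomisticToContinuum.FouriersLaw.Theorems.IncoherentChannel.Negative.LineResistance
  (endAutocorr_sq_le_fnorm)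

/-! ### Assembly on the product space: the echo identity and its Cauchy–Schwarz bound -/

section Core

variable {ω₂ lam β γ T : ℝ} (hω : 0 < ω₂) (hl : 0 ≤ lam) (hβ : 0 ≤ β) (hγ : 0 ≤ γ) (hT : 0 < T) (N : ℕ)
include hω hl hβ hγ hT

/-- **The echo moves at most linearly at one `N`, given an `L²(μ₀)` bound `D²` on the bath-site drift**:
for `t ≥ 0`, `|a_N(t) − T| ≤ √T · √D² · t`, `a_N(t) = ∫ p_N v_t dμ₀ = E_{μ₀ ⊗ W}[p_N(0) p_N(t)]`. On `μ₀ ⊗ W`: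
`E[p_N(0) p_N(t)] = E[p_N(0)²] + √(2γT)·E[p_N(0) B_t] + E[p_N(0) ∫₀ᵗ Y_N] = T + 0 + E[p_N(0) ∫₀ᵗ Y_N]` by the
pathwise SDE, and `|E[p_N(0) ∫₀ᵗ Y_N]|² ≤ T · t² D²` by Cauchy–Schwarz. [folklore] -/
theorem endAutocorr_sub_abs_le_of_driftBound {Dsq : ℝ}
    (hDi : Integrable (fun z : PhaseSpace (N + 1) => ((pinnedChain ω₂ lam β γ).drift (N + 1) z).2 (Fin.last N) ^ 2)
      ((pinnedChain ω₂ lam β γ).gibbsMeasure (N + 1) T))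
    (hD : ∫ z, ((pinnedChain ω₂ lam β γ).drift (N + 1) z).2 (Fin.last N) ^ 2
      ∂((pinnedChain ω₂ lam β γ).gibbsMeasure (N + 1) T) ≤ Dsq)
    {t : ℝ} (ht : 0 ≤ t) :
    |(∫ z, z.2 (Fin.last N) * fcast ω₂ lam β γ T N t z ∂((pinnedChain ω₂ lam β γ).gibbsMeasure (N + 1) T)) - T| ≤
      Real.sqrt T * Real.sqrt Dsq * t := by
  set μ₀ := (pinnedChain ω₂ lam β γ).gibbsMeasure (N + 1) T with hμ₀
  haveI hμprob : IsProbabilityMeasure μ₀ := pinnedChain_isProbabilityMeasure_gibbsMeasure hω hl hβ γ (N + 1) hT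
  set Pμ : Measure (PhaseSpace (N + 1) × WienerPair) := μ₀.prod wienerPair with hPμ
  set b : Fin (N + 1) := Fin.last N with hb
  set t' : ℝ≥0 := t.toNNReal with ht'def
  have ht' : ((t' : ℝ≥0) : ℝ) = t := Real.coe_toNNReal t ht
  have hDsq0 : 0 ≤ Dsq := (integral_nonneg fun z => sq_nonneg _).trans hD
  -- the random variables on `μ₀ ⊗ W`
  set X : PhaseSpace (N + 1) × WienerPair → ℝ := fun p =>
    ((pinnedChain ω₂ lam β γ).solMap (N + 1) T T t p.1 (pairPath p.2)).2 b with hX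
  set W : PhaseSpace (N + 1) × WienerPair → ℝ := fun p => brownian t' p.2.2 with hW
  set B1 : PhaseSpace (N + 1) × WienerPair → ℝ := fun p => brownian t' p.2.1 with hB1
  set P0 : PhaseSpace (N + 1) × WienerPair → ℝ := fun p => p.1.2 b with hP0
  set I : PhaseSpace (N + 1) × WienerPair → ℝ := fun p => ∫ s in (0 : ℝ)..t,
    ((pinnedChain ω₂ lam β γ).drift (N + 1)
      ((pinnedChain ω₂ lam β γ).solMap (N + 1) T T s p.1 (pairPath p.2))).2 b with hI
  set c : ℝ := Real.sqrt (2 * γ * T) with hc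
  set χ : ℝ := (if b.val = 0 then c else 0) with hχ
  -- the pathwise SDE of the bath momentum
  have hsde : ∀ p, X p = P0 p + (χ * B1 p + c * W p) + I p := fun p => by
    have h := contactLoss_momentum_sde hω hl hβ hγ T N ht p.1 p.2
    simpa only [hX, hP0, hB1, hW, hI, hχ, hc, hb, ht'def] using h
  -- measurability
  have hXm : Measurable X :=
    (by fun_prop : Measurable fun y : PhaseSpace (N + 1) => y.2 b).comp
      (pinnedChain_measurable_solMap_pairPath hω hl hβ hγ (N + 1) T T t)
  have hWm : Measurable W := (measurable_brownian t').comp (measurable_snd.comp measurable_snd)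
  have hB1m : Measurable B1 := (measurable_brownian t').comp (measurable_fst.comp measurable_snd)
  have hP0m : Measurable P0 := (by fun_prop : Measurable fun y : PhaseSpace (N + 1) => y.2 b).comp measurable_fst
  have hIeq : I = fun p => X p - P0 p - (χ * B1 p + c * W p) := by
    funext p; rw [hsde p]; ring
  have hIm : Measurable I := by
    rw [hIeq]
    exact (hXm.sub hP0m).sub ((hB1m.const_mul χ).add (hWm.const_mul c))
  -- equipartition `∫ p_N² dμ₀ = T`
  obtain ⟨hip, hbp⟩ := commonPastBound_gibbsEvenMoments ω₂ lam β γ hω hl hβ T hT (N + 1) b 1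
  simp only [Nat.mul_one] at hip hbp
  simp only [pow_one, Finset.range_one, Finset.prod_singleton, Nat.cast_zero, mul_zero, zero_add, mul_one] at hbp
  have hp2m : StronglyMeasurable fun y : PhaseSpace (N + 1) => y.2 b ^ 2 :=
    (by fun_prop : Continuous fun y : PhaseSpace (N + 1) => y.2 b ^ 2).stronglyMeasurable
  -- second moments on the product space
  have hX2 : Integrable (fun p => X p ^ 2) Pμ := by
    obtain ⟨h1, -⟩ := contactLoss_integral_solMap_prod hω hl hβ hγ hT N t' hp2m hip
    rw [ht'] at h1
    exact h1
  have hP02 : Integrable (fun p => P0 p ^ 2) Pμ := hip.comp_fst wienerPair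
  have hP02val : ∫ p, P0 p ^ 2 ∂Pμ = T := by
    have h := integral_fun_fst (μ := μ₀) (ν := wienerPair) (fun z : PhaseSpace (N + 1) => z.2 b ^ 2)
    rw [probReal_univ, one_smul] at h
    exact h.trans hbp
  have hW2 : Integrable (fun p => W p ^ 2) Pμ := (integrable_brownian_snd_pow t' 2).comp_snd μ₀
  have hB12 : Integrable (fun p => B1 p ^ 2) Pμ := (integrable_brownian_fst_pow t' 2).comp_snd μ₀
  -- products with `P0`
  have hP0Xi : Integrable (fun p => P0 p * X p) Pμ :=
    lightCone_integrable_mul_of_sq hP0m.aestronglyMeasurable hXm.aestronglyMeasurable hP02 hX2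
  have hP0Wi : Integrable (fun p => P0 p * W p) Pμ :=
    lightCone_integrable_mul_of_sq hP0m.aestronglyMeasurable hWm.aestronglyMeasurable hP02 hW2
  have hP0B1i : Integrable (fun p => P0 p * B1 p) Pμ :=
    lightCone_integrable_mul_of_sq hP0m.aestronglyMeasurable hB1m.aestronglyMeasurable hP02 hB12
  have hP0W : ∫ p, P0 p * W p ∂Pμ = 0 := by
    have h := integral_prod_mul (μ := μ₀) (ν := wienerPair) (fun z : PhaseSpace (N + 1) => z.2 b)
      (fun ω : WienerPair => brownian t' ω.2)
    rw [integral_brownian_snd, mul_zero] at h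
    exact h
  have hP0B1 : ∫ p, P0 p * B1 p ∂Pμ = 0 := by
    have h := integral_prod_mul (μ := μ₀) (ν := wienerPair) (fun z : PhaseSpace (N + 1) => z.2 b)
      (fun ω : WienerPair => brownian t' ω.1)
    rw [integral_brownian_fst, mul_zero] at h
    exact h
  -- the integrated drift
  have hIlint : ∫⁻ p, ENNReal.ofReal (I p ^ 2) ∂Pμ ≤ ENNReal.ofReal (t ^ 2 * Dsq) :=
    contactLoss_lintegral_driftIntegral_sq_le hω hl hβ hγ hT N ht hDi hD
  have hI2 : Integrable (fun p => I p ^ 2) Pμ :=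
    ⟨(hIm.pow_const 2).aestronglyMeasurable,
      (hasFiniteIntegral_iff_ofReal (ae_of_all _ fun p => sq_nonneg (I p))).2
        (lt_of_le_of_lt hIlint ENNReal.ofReal_lt_top)⟩
  have hI2le : ∫ p, I p ^ 2 ∂Pμ ≤ t ^ 2 * Dsq := by
    rw [integral_eq_lintegral_of_nonneg_ae (ae_of_all _ fun p => sq_nonneg (I p))
      (hIm.pow_const 2).aestronglyMeasurable]
    exact ENNReal.toReal_le_of_le_ofReal (by positivity) hIlint
  have hP0Ii : Integrable (fun p => P0 p * I p) Pμ :=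
    lightCone_integrable_mul_of_sq hP0m.aestronglyMeasurable hIm.aestronglyMeasurable hP02 hI2
  -- `E[P0 X] = a_N(t)` (Fubini; the kernel is the law of the solution map under `W`)
  have hP0X : ∫ p, P0 p * X p ∂Pμ = ∫ z, z.2 b * fcast ω₂ lam β γ T N t z ∂μ₀ := by
    rw [integral_prod _ hP0Xi]
    have hin : ∀ z : PhaseSpace (N + 1), ∫ ω, P0 (z, ω) * X (z, ω) ∂wienerPair =
        z.2 b * fcast ω₂ lam β γ T N t z := by
      intro z
      simp only [hX, hP0]
      rw [integral_const_mul, ← lightCone_fcast_eq_integral_solMap hω hl hβ hγ N ht z]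
    simp_rw [hin]
  -- `E[P0 X] = T + E[P0 I]`
  have hE : ∫ p, P0 p * X p ∂Pμ = T + ∫ p, P0 p * I p ∂Pμ := by
    have e : (fun p => P0 p * X p) = fun p => (P0 p ^ 2 + χ * (P0 p * B1 p)) + (c * (P0 p * W p) + P0 p * I p) := by
      funext p; rw [hsde p]; ring
    have hχB : Integrable (fun p => χ * (P0 p * B1 p)) Pμ := hP0B1i.const_mul χ
    have hcW : Integrable (fun p => c * (P0 p * W p)) Pμ := hP0Wi.const_mul c
    have h12 : Integrable (fun p => P0 p ^ 2 + χ * (P0 p * B1 p)) Pμ := hP02.add hχB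
    have h34 : Integrable (fun p => c * (P0 p * W p) + P0 p * I p) Pμ := hcW.add hP0Ii
    rw [e, integral_add h12 h34, integral_add hP02 hχB, integral_add hcW hP0Ii, integral_const_mul,
      integral_const_mul, hP0B1, hP0W, hP02val]
    ring
  -- Cauchy–Schwarz on `μ₀ ⊗ W`
  have hCS : (∫ p, P0 p * I p ∂Pμ) ^ 2 ≤ T * (t ^ 2 * Dsq) := by
    have h := lightCone_integral_mul_sq_le (μ := Pμ) (f := P0) (g := I)
      hP0m.aestronglyMeasurable hIm.aestronglyMeasurable hP02 hI2
    rw [hP02val] at h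
    exact h.trans (mul_le_mul_of_nonneg_left hI2le hT.le)
  -- the elementary endgame
  set J := ∫ p, P0 p * I p ∂Pμ with hJdef
  set ρ : ℝ := Real.sqrt T * Real.sqrt Dsq * t with hρ
  have hsT : Real.sqrt T ^ 2 = T := Real.sq_sqrt hT.le
  have hsD : Real.sqrt Dsq ^ 2 = Dsq := Real.sq_sqrt hDsq0
  have hρ2 : ρ ^ 2 = T * (t ^ 2 * Dsq) := by
    simp only [hρ]; rw [mul_pow, mul_pow, hsT, hsD]; ring
  have hρ0 : 0 ≤ ρ := by positivity
  have hJ : |J| ≤ ρ := by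
    have : J ^ 2 ≤ ρ ^ 2 := by rw [hρ2]; exact hCS
    exact abs_le_of_sq_le_sq this hρ0
  rw [← hP0X, hE, add_sub_cancel_left]
  exact hJ

end Core

/-! ### The registered-vocabulary statements: `N`-uniform short-time persistence -/

/-- **`N`-UNIFORM SHORT-TIME PERSISTENCE OF THE ECHO.** For the pinned chain `pinnedChain ω₂ lam β γ`
(`ω₂ > 0`, `lam, β, γ ≥ 0`) with both baths at `T > 0` there is `D = D(ω₂, lam, β, γ, T) ≥ 0`, INDEPENDENT OF `N`,
such that for every `N` and every `t ≥ 0`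

  `T − D t ≤ a_N(t) = ⟨p_N, K_t p_N⟩_{μ₀} = E[p_N(0) p_N(t)]`:

the echo of the bath momentum cannot drop faster than linearly, whatever the length of the chain (pathwise SDE of
`p_N`, equipartition, the Brownian cross term vanishes, Cauchy–Schwarz on `μ₀ ⊗ W` with the `N`-uniform Gibbs second
moment of the bath-site drift; `D = √T·√D²`). Registered helper for `stub_forecastLoss` (line
`two-horizons-forecast-loss` of crux `PhononMeanFreePath.IncoherentChannel`); it does not close the stub. [folklore] -/
theorem endAutocorr_persistence : ∀ ω₂ lam β γ : ℝ, 0 < ω₂ → 0 ≤ lam → 0 ≤ β → 0 ≤ γ → ∀ T : ℝ, 0 < T → ∃ D : ℝ, 0 ≤ D ∧ ∀ (N : ℕ) (t : ℝ), 0 ≤ t → T - D * t ≤ ∫ z, z.2 (Fin.last N) * fcast ω₂ lam β γ T N t z ∂((pinnedChain ω₂ lam β γ).gibbsMeasure (N + 1) T) := by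
  intro ω₂ lam β γ hω hl hβ hγ T hT
  obtain ⟨Dsq, -, hDsq⟩ := contactLoss_drift_last_sq_gibbs (γ := γ) hω hl hβ hT
  refine ⟨Real.sqrt T * Real.sqrt Dsq, by positivity, fun N t ht => ?_⟩
  obtain ⟨hDi, hD⟩ := hDsq N
  have h := endAutocorr_sub_abs_le_of_driftBound hω hl hβ hγ hT N hDi hD ht
  have h' := (abs_le.1 h).1
  linarith

/-- **`N`-UNIFORM SHORT-TIME PERSISTENCE OF THE FORECAST NORM.** With the SAME `N`-independent `D ≥ 0` as in
`endAutocorr_persistence`: for every `N` and every `t ≥ 0` with `D t ≤ T`,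

  `(T − D t)² / T ≤ S_N(t) = ‖K_t p_N‖²_{L²(μ₀)}`

(`0 ≤ T − D t ≤ a_N(t)` and Cauchy–Schwarz `a_N(t)² ≤ T · S_N(t)`, `endAutocorr_sq_le_fnorm`). Together with the
upper law `contactLoss_fnorm_le` this pins the short-time behaviour of `S_N` uniformly in `N`:
`T − 2D t ≤ S_N(t) ≤ T − 2γT t + O(t^{3/2})`. Registered helper for `stub_forecastLoss`; it does not close the stub.
[folklore] -/
theorem fnorm_persistence : ∀ ω₂ lam β γ : ℝ, 0 < ω₂ → 0 ≤ lam → 0 ≤ β → 0 ≤ γ → ∀ T : ℝ, 0 < T → ∃ D : ℝ, 0 ≤ D ∧ ∀ (N : ℕ) (t : ℝ), 0 ≤ t → D * t ≤ T → (T - D * t) ^ 2 / T ≤ fnorm ω₂ lam β γ T N t := by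
  intro ω₂ lam β γ hω hl hβ hγ T hT
  obtain ⟨D, hD0, hD⟩ := endAutocorr_persistence ω₂ lam β γ hω hl hβ hγ T hT
  refine ⟨D, hD0, fun N t ht hDt => ?_⟩
  have ha := hD N t ht
  have hsq := endAutocorr_sq_le_fnorm hω hl hβ hγ hT N t
  have hnn : 0 ≤ T - D * t := sub_nonneg.2 hDt
  have h2 : (T - D * t) ^ 2 ≤ T * fnorm ω₂ lam β γ T N t := (pow_le_pow_left₀ hnn ha 2).trans hsq
  rw [div_le_iff₀ hT]
  linarith [h2]

end Summit.AtomisticToContinuum.FouriersLaw.Theorems.PhononMeanFreePath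

end
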